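import Literature.MathematicalPhysics.QuantumFieldTheory.Balaban1983to89.T4InputCauchyRateData

/-!
# NE5 ∕ U3 — the LINEAR AGE-WEIGHTED INSERTION CLASS: the printed-STRUCTURE binders `InsAffine` ∕ `InsBlind` ∕ `InsHomog`
# hold BY CONSTRUCTION, and W3 `InsScaleBound` ⇐ ONE one-run ℓ¹ age budget of the insertion vectors
# (skeleton `t4/skeletons/NE5-t4-ne5-p2.md` §6 row A3)

Cell `pub-balaban`, unit `b2b-balaban-t4-ne5-p2-g17` (T⁴ fan-out NE5 ∕ node U3, PROVER seat P2 «polymer-activity Lipschitz route»).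
Summits-side new work under the LEAN PLACEMENT RULE (cell modelling + bookkeeping; NOT a Literature module).  HONEST FRAMING: rung
(B)+1 of the FINITE-VOLUME T⁴ continuum programme — NOT infinite volume, NOT a mass gap, NOT the Clay problem, NOT a proof of NE5
(NOT PRINTED in [Balaban1987RG1]–[Balaban1989LargeFieldII]; they print ε-UNIFORM bounds, never η-RATES).  HONEST DEPENDENCY (cell
line, verbatim): continuum YM on T⁴ ⇐ BetaPertH ∧ nine spine estimates (0/9 proved); BetaPertH ⇐ (D1) ∧ (D4) ∧ CAP+tail; G-an2-4
gates asym, D1 and NE2/3/4.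

WHAT THIS FILE DOES.  The END faces of both kernel routes to NE5 (`T4InputCauchyRateData.StepModel.ne5_at_of_stepModel_lip_nat`,
`ActivityStepJunction.TermFamily.ne5_above_max_of_model_reach_step`, `ActivityRouteEnd.*`) consume FOUR binders about run A's
history INSERTION `M.insA g U k : (C.Dom → ℝ) → Hist` (the map «table of earlier outputs ↦ inserted history datum»):
the printed-STRUCTURE shapes `StepModel.InsAffine` ∕ `InsBlind` ∕ `InsHomog` (skeleton leaf L12-structure) and the one-run
single-scale size bound `StepModel.InsScaleBound W κ E₁ c ω` (W3 = leaf L12-level, cell gap G-ne5p1-3a″).  Printed STRUCTURE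
([Balaban1988RG2Cluster] Lemma 1 (1.33) p. 9, Lemma 2 (1.41) p. 11; [Balaban1987RG1] (0.28)–(0.30) p. 258): the earlier actions
enter the step-`k` fluctuation action LINEARLY, domain by domain, and every localisation operation ((1.22)–(1.24) p. 7) is linear
in each `E^{(j)}(Y)`; only scales `j < k` are read.  This file types that structure as a CLASS and proves:
* `LinearInsertion C Hist` (DATA): per step `k` a FINITE set `dom k` of earlier domains (all of scale `< k`), a
  table-independent part `base g U k` and insertion VECTORS `vec g U k Y : Hist`; the insertion
  `ins g U k t = base g U k + Σ_{Y ∈ dom k} (t Y : ℂ) • vec g U k Y`;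
* `Reads L M W` (the step model's `insA` IS `L.ins` on the window) ⟹ `M.InsAffine W`, `M.InsBlind W`, `M.InsHomog W`
  (`insAffine_of_reads`, `insBlind_of_reads`, `insHomog_of_reads`) — BY CONSTRUCTION, no estimate;
* the ONE one-run estimate the class needs for W3, typed as the binder `AgeBudget L M W κ c ω`: the `e^{−κd}`-weighted ℓ¹ sum
  of the scale-`j` insertion vectors at step `k` is at most `c·ω^{k−1−j}` history margins,
  `Σ_{Y ∈ dom k, scale Y = j} e^{−κ d(Y)}·‖vec g U k Y‖ ≤ rHist k · c · ω^{k−1−j}` — the printed KIND is the age bookkeeping of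
  [Balaban1988RG2Cluster] p. 8 *"This yields (6L)⁴Lʲη"* ∕ (1.24) p. 7 (the factor (Lʲη)⁵E₀ of the j-th term) and
  [Balaban1987RG1] (0.29) p. 258 (one run, one scale, the run's own earlier action; the statement for arbitrary insertion
  vectors in history-margin units is NOT PRINTED — it is W3 itself, displayed);
  then `insScaleBoundLevel_of_ageBudget` ∕ `insScaleBound_of_ageBudget`: `Reads ∧ AgeBudget ⟹ M.InsScaleBoundLevel W κ c ω` and
  `M.InsScaleBound W κ E₁ c ω` for every level `E₁ ≥ 0` (triangle inequality + the budget; nothing else).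
So for the linear class leaf L12 reduces to ONE displayed one-run binder (`AgeBudget`) + the reading; what remains OPEN is
«Bałaban's insertion is in the class with these vectors and this budget» (skeleton O3), not hidden.  No `sorry`, no new axioms.
ABSOLUTE RULE respected: the manuscripts under audit are cited for KIND∕locus only; nothing of them is asserted.
-/

open scoped BigOperators

namespace Summit.QuantumFields.BalabanUV.T4Continuum.InsertionLinearClass

open Literature.MathematicalPhysics.QuantumFieldTheory.Balaban1983to89.T4OutputRate (Carriers)
open Literature.MathematicalPhysics.QuantumFieldTheory.Balaban1983to89.T4InputCauchyRateData (StepModel)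

variable {C : Carriers} {Op Hist : Type*} [NormedAddCommGroup Op] [NormedSpace ℂ Op] [NormedAddCommGroup Hist]
  [NormedSpace ℂ Hist]

/-- [folklore] DATA (no inequality inside): a LINEAR AGE-WEIGHTED INSERTION — at step `k` a finite set `dom k` of earlier
domains (each of scale `< k`), a table-independent part `base`, and one insertion vector per earlier domain. -/
structure LinearInsertion (C : Carriers) (Hist : Type*) [NormedAddCommGroup Hist] [NormedSpace ℂ Hist] where
  /-- the earlier domains read at step `k` -/
  dom : ℕ → Finset C.Dom
  /-- only scales `< k` are read (causality of the recursion, (1.33)/(1.41)) -/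
  dom_lt : ∀ k, ∀ Y ∈ dom k, C.scale Y < k
  /-- the table-independent part of the inserted history -/
  base : (ℕ → ℝ) → C.BgB → ℕ → Hist
  /-- the insertion vector of the earlier domain `Y` at step `k` -/
  vec : (ℕ → ℝ) → C.BgB → ℕ → C.Dom → Hist

namespace LinearInsertion

variable (L : LinearInsertion C Hist)

/-- [folklore] The insertion of the class: `base + Σ_{Y ∈ dom k} (t Y) • vec Y`. -/
def ins (g : ℕ → ℝ) (U : C.BgB) (k : ℕ) (t : C.Dom → ℝ) : Hist :=
  L.base g U k + ∑ Y ∈ L.dom k, ((t Y : ℝ) : ℂ) • L.vec g U k Y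

/-- [folklore] HYPOTHESIS SHAPE (reading): on the window, run A's insertion of the step model IS the class's insertion. -/
def Reads (M : StepModel C Op Hist) (W : Set (ℕ → ℝ)) : Prop :=
  ∀ k, ∀ g ∈ W, ∀ (U : C.BgB) (t : C.Dom → ℝ), M.insA g U k t = L.ins g U k t

/-- [folklore] HYPOTHESIS SHAPE (the ONE one-run estimate of the class, displayed — W3 in vector form; NOT PRINTED as a
statement about insertion vectors, printed KIND = the age bookkeeping (Lʲη)-factors of [Balaban1988RG2Cluster] p. 8 ∕ (1.24)):
the `e^{−κd}`-weighted ℓ¹ sum of the scale-`j` insertion vectors at step `k` is at most `c·ω^{k−1−j}` history margins. -/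
def AgeBudget (M : StepModel C Op Hist) (W : Set (ℕ → ℝ)) (κ c ω : ℝ) : Prop :=
  ∀ k, ∀ g ∈ W, ∀ (U : C.BgB) (j : ℕ), j < k →
    ∑ Y ∈ (L.dom k).filter (fun Y => C.scale Y = j), Real.exp (-(κ * C.d Y)) * ‖L.vec g U k Y‖ ≤
      M.rHist k * (c * ω ^ (k - 1 - j))

/-- [folklore] The table-driven part of the class's insertion is the vector sum. -/
theorem ins_sub_ins_zero (g : ℕ → ℝ) (U : C.BgB) (k : ℕ) (t : C.Dom → ℝ) :
    L.ins g U k t - L.ins g U k 0 = ∑ Y ∈ L.dom k, ((t Y : ℝ) : ℂ) • L.vec g U k Y := by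
  simp [ins]

/-- [folklore] Differences of insertions are the insertion of the difference table (minus the base). -/
theorem ins_sub_ins (g : ℕ → ℝ) (U : C.BgB) (k : ℕ) (t t' : C.Dom → ℝ) :
    L.ins g U k t - L.ins g U k t' = ∑ Y ∈ L.dom k, (((t Y - t' Y : ℝ)) : ℂ) • L.vec g U k Y := by
  simp only [ins, add_sub_add_left_eq_sub, ← Finset.sum_sub_distrib, ← sub_smul, ← Complex.ofReal_sub]

variable {L} {M : StepModel C Op Hist} {W : Set (ℕ → ℝ)}

/-- [folklore] **`InsAffine` BY CONSTRUCTION** for the linear class. -/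
theorem insAffine_of_reads (h : L.Reads M W) : M.InsAffine W := by
  intro k g hg U t t'
  rw [h k g hg U t, h k g hg U t', h k g hg U (t - t'), h k g hg U 0, L.ins_sub_ins, L.ins_sub_ins_zero]
  rfl

/-- [folklore] **`InsBlind` BY CONSTRUCTION**: the class reads only `dom k`, all of scale `< k`. -/
theorem insBlind_of_reads (h : L.Reads M W) : M.InsBlind W := by
  intro k g hg U t t' htt'
  rw [h k g hg U t, h k g hg U t', ← sub_eq_zero, L.ins_sub_ins]
  refine Finset.sum_eq_zero fun Y hY => ?_
  rw [htt' Y (L.dom_lt k Y hY), sub_self, Complex.ofReal_zero, zero_smul]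

/-- [folklore] **`InsHomog` BY CONSTRUCTION**: the table-driven part is ℝ-linear. -/
theorem insHomog_of_reads (h : L.Reads M W) : M.InsHomog W := by
  intro k g hg U a t
  rw [h k g hg U (a • t), h k g hg U 0, h k g hg U t, L.ins_sub_ins_zero, L.ins_sub_ins_zero, Finset.smul_sum]
  refine Finset.sum_congr rfl fun Y _ => ?_
  rw [Pi.smul_apply, smul_eq_mul, Complex.ofReal_mul, mul_smul]

/-- [folklore] The norm of the table-driven part for a table supported on the single scale `j` with entries `≤ T·e^{−κd}`:
`‖ins t − ins 0‖ ≤ T · Σ_{Y ∈ dom k, scale Y = j} e^{−κ d(Y)}‖vec Y‖` (triangle inequality). -/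
theorem norm_ins_sub_ins_zero_le (g : ℕ → ℝ) (U : C.BgB) (k : ℕ) {κ : ℝ} {t : C.Dom → ℝ} {j : ℕ} {T : ℝ}
    (hsupp : ∀ Y, C.scale Y ≠ j → t Y = 0) (hbd : ∀ Y, C.scale Y = j → |t Y| ≤ T * Real.exp (-(κ * C.d Y))) :
    ‖L.ins g U k t - L.ins g U k 0‖ ≤
      T * ∑ Y ∈ (L.dom k).filter (fun Y => C.scale Y = j), Real.exp (-(κ * C.d Y)) * ‖L.vec g U k Y‖ := by
  rw [L.ins_sub_ins_zero]
  -- drop the domains of other scales (their table entries vanish)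
  have hsplit : ∑ Y ∈ L.dom k, ((t Y : ℝ) : ℂ) • L.vec g U k Y =
      ∑ Y ∈ (L.dom k).filter (fun Y => C.scale Y = j), ((t Y : ℝ) : ℂ) • L.vec g U k Y := by
    rw [Finset.sum_filter]
    refine Finset.sum_congr rfl fun Y _ => ?_
    by_cases hY : C.scale Y = j
    · simp [hY]
    · simp [hsupp Y hY, hY]
  rw [hsplit, Finset.mul_sum]
  refine (norm_sum_le _ _).trans (Finset.sum_le_sum fun Y hY => ?_)
  rw [Finset.mem_filter] at hY
  rw [norm_smul, Complex.norm_real, Real.norm_eq_abs]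
  calc |t Y| * ‖L.vec g U k Y‖ ≤ T * Real.exp (-(κ * C.d Y)) * ‖L.vec g U k Y‖ :=
        mul_le_mul_of_nonneg_right (hbd Y hY.2) (norm_nonneg _)
    _ = T * (Real.exp (-(κ * C.d Y)) * ‖L.vec g U k Y‖) := by ring

/-- [folklore] **W3 at an arbitrary level from the age budget**: `Reads ∧ AgeBudget κ c ω ⟹ M.InsScaleBoundLevel W κ c ω`. -/
theorem insScaleBoundLevel_of_ageBudget {κ c ω : ℝ} (h : L.Reads M W) (hb : L.AgeBudget M W κ c ω) :
    M.InsScaleBoundLevel W κ c ω := by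
  intro k g hg U t j T hj hT hsupp hbd
  rw [h k g hg U t, h k g hg U 0]
  calc ‖L.ins g U k t - L.ins g U k 0‖
      ≤ T * ∑ Y ∈ (L.dom k).filter (fun Y => C.scale Y = j), Real.exp (-(κ * C.d Y)) * ‖L.vec g U k Y‖ :=
        L.norm_ins_sub_ins_zero_le g U k hsupp hbd
    _ ≤ T * (M.rHist k * (c * ω ^ (k - 1 - j))) := mul_le_mul_of_nonneg_left (hb k g hg U j hj) hT
    _ = M.rHist k * (c * (ω ^ (k - 1 - j) * T)) := by ring

/-- [folklore] **W3 at the reference level `E₁ ≥ 0` from the age budget**: `Reads ∧ AgeBudget κ c ω ⟹ M.InsScaleBound W κ E₁ c ω`. -/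
theorem insScaleBound_of_ageBudget {κ E₁ c ω : ℝ} (h : L.Reads M W) (hb : L.AgeBudget M W κ c ω) (hE₁ : 0 ≤ E₁) :
    M.InsScaleBound W κ E₁ c ω :=
  fun k g hg U t j hj hsupp hbd => insScaleBoundLevel_of_ageBudget h hb k g hg U t j E₁ hj hE₁ hsupp hbd

/-- [folklore] **The four insertion binders of the END faces, for the linear class, from the reading and ONE one-run budget.** -/
theorem insertion_binders_of_reads {κ E₁ c ω : ℝ} (h : L.Reads M W) (hb : L.AgeBudget M W κ c ω) (hE₁ : 0 ≤ E₁) :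
    M.InsAffine W ∧ M.InsBlind W ∧ M.InsHomog W ∧ M.InsScaleBound W κ E₁ c ω :=
  ⟨insAffine_of_reads h, insBlind_of_reads h, insHomog_of_reads h, insScaleBound_of_ageBudget h hb hE₁⟩

end LinearInsertion

/-! ## A two-domain instance (non-vacuity of the class and of the budget) -/

section Toy

/-- [folklore] Reducible toy carriers for the class's non-vacuity check: domains = creation steps `k ∈ ℕ`, no tree length,
trivial backgrounds (the same data as the lineage's `T4InputCauchyRate.toyCarriers`, declared `abbrev` so that `Dom` unfolds
to `ℕ` for instance search). -/
abbrev linToyCarriers : Carriers where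
  Dom := ℕ
  scale := fun k => k
  d := fun _ => 0
  d_nonneg := fun _ => le_rfl
  BgA := Unit
  BgB := Unit
  gauge := fun _ _ => 0
  gauge_nonneg := fun _ _ => le_rfl
  transport := fun u => u

/-- [folklore] The toy linear insertion: at step `k` the domains `0, …, k − 1` are read with vectors `ω^{k−1−Y}` (age damping
`ω`), no base part. -/
noncomputable def toyIns (ω : ℝ) : LinearInsertion linToyCarriers ℂ where
  dom k := Finset.range k
  dom_lt _ _ hY := Finset.mem_range.1 hY
  base _ _ _ := 0
  vec _ _ k Y := (((ω ^ (k - 1 - Y) : ℝ)) : ℂ)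

/-- [folklore] The toy's age budget with `c = 1` holds for every step model with unit history margins, `0 ≤ ω`
(at step `k` exactly one domain has scale `j < k`, with weight `e^0·ω^{k−1−j}`). -/
theorem toy_ageBudget {Op : Type*} [NormedAddCommGroup Op] [NormedSpace ℂ Op] (M : StepModel linToyCarriers Op ℂ)
    (hM : ∀ k, M.rHist k = 1) {ω : ℝ} (hω : 0 ≤ ω) (κ : ℝ) (W : Set (ℕ → ℝ)) :
    (toyIns ω).AgeBudget M W κ 1 ω := by
  intro k g _ U j hj
  have hfilter : ((toyIns ω).dom k).filter (fun Y : ℕ => Y = j) = ({j} : Finset ℕ) := by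
    ext Y
    simp only [toyIns, Finset.mem_filter, Finset.mem_range, Finset.mem_singleton]
    exact ⟨fun h => h.2, fun h => ⟨h ▸ hj, h⟩⟩
  change ∑ Y ∈ ((toyIns ω).dom k).filter (fun Y : ℕ => Y = j), Real.exp (-(κ * 0)) * ‖(((ω ^ (k - 1 - Y) : ℝ)) : ℂ)‖
    ≤ M.rHist k * (1 * ω ^ (k - 1 - j))
  rw [hfilter, Finset.sum_singleton, mul_zero, neg_zero, Real.exp_zero, one_mul, Complex.norm_real, Real.norm_eq_abs,
    abs_of_nonneg (pow_nonneg hω _), hM, one_mul, one_mul]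

end Toy

end Summit.QuantumFields.BalabanUV.T4Continuum.InsertionLinearClass
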